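/-
Copyright (c) 2026. All rights reserved.
Released under Apache 2.0 license as described in the file LICENSE.
-/
import Literature.Geometry.Kaehler.ComplexTorusQuaternionMaximalOrderNormaliser
import Literature.Geometry.Kaehler.ComplexTorusQuaternionXSixStabilisers
import HarnessLib

/-!
# Stabilisers in `Γ₆⁺ = N(O₆)`: the exact isotropy of the special points on `X₆⁺ = X₆/W` and on `X₆^{(2)}, X₆^{(3)}, X₆^{(6)}`
# — `e = 4, 6, 2` at `P₆, P₄, P₀` (Bayer–Travesa 2007, Table 9 and §7; KRY 2006 (3.4.14))

[tag: complex_torus] [tag: abelian_surface] [tag: quaternion_multiplication] [tag: complex_multiplication]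
[tag: shimura_curve] [tag: special_cycles] [tag: elliptic_points] [tag: atkin_lehner]

Lane `lit-hodgefound`, seat p12, row g33-#5 — THEOREMS ONLY (no definition, no named fact, no instance); the sequel of g33-#4
`…MaximalOrderNormaliser` (`N(O₆) = ℚ^×·O₆^{±1}·{1, 1 + i, μ, (1 + i)μ}` exhausted) and g31-#8 `…XSixStabilisers` (stabilisers
in `Γ₆ = O₆¹`: `uy = yu ⟺ u ∈ ℚ + ℚy`, `e_x ∈ {2, 4, 6}`), closing what g32-#3 `…XSixAtkinLehnerPoints` left cited («the EXACT
isotropy orders of Table 9 stay cited»). Setting as there: `B = (−1,3)_ℚ`, `𝔬 = ℤ⟨1, i, j, ij⟩`, `O₆` as the predicate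
`x ∈ 𝔬 ∨ x − e ∈ 𝔬`, special vectors `y = p₁i + p₂j + p₃ij` with `Q(y) = p₁² − 3p₂² − 3p₃²`, primitivity as a Bézout relation;
`g ∈ N(O₆)` as `O₆g ⊆ gO₆` (equivalent to `gO₆ ⊆ O₆g` and to `gO₆ = O₆g` for `g ≠ 0`, g33-#4). The STABILISER of the point `z_y`
in `Γ₆⁺ = N(O₆)` (modulo the centre `ℚ^×`) is `{g ∈ N(O₆) : gy = yg}/ℚ^×` (an element of positive norm fixing `z_y` commutes
with `y`; anticommuting forces `nr ≤ 0`, g32-#3 `norm_nonpos_of_anticommute`); its image in `X₆^{(d)} = X₆/⟨ω_d⟩` is cut out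
by `nr ∈ ℚ^{×2}·{1, d}`. Points: `P₆ = z_i` (`Q = 1`), `P₄ = z_{R₁}`, `R₁ = 3i + j + ij` (`Q = 3`), `P₀ = z_{S₂}`,
`S₂ = 3i + ij = w₆` (`Q = 6`) — the triangle `t₆⁺ = [P₀, P₄, P₆]`.

## The print, VERBATIM

* P. Bayer, A. Travesa (2007) [BayerTravesa2007] §2 p. 318: «The elements of `N(O₆)` of positive reduced norm define a
  subgroup whose image in `GL⁺(2, ℝ)` will be denoted by `Γ₆⁺` … the quotient `Γ₆⁺/Γ₆` is isomorphic to `(ℤ/2ℤ)²`. Its classes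
  are represented by elements `w_d ∈ O₆` of norm `d` dividing `D = 6`. They give rise to involutions of the curve `X₆`,
  denoted `ω_d`»; §7 p. 332: «Observe that `P₀` is an elliptic point for `X₆^{(6)}` and `X₆⁺`, but it is not elliptic for `X₆`,
  `X₆^{(2)}` and `X₆^{(3)}`»; Table 9 (the triangle `[P₀, P₄, P₆]` of `t₆⁺`): `e_{P₀} = 2`, `e_{P₄} = 6`, `e_{P₆} = 4`; §1
  Thm. 1.1: «The vertices `P₁ ≡ P₃ ≡ P₅ (mod Γ₆)` and `P₆` are elliptic of order `2`; the remaining vertices `P₂, P₄` are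
  elliptic of order `3`.»
* S. Kudla, M. Rapoport, T. Yang (2006) [KudlaRapoportYang2006] §3.4 (3.4.14): «`deg Z(t)_ℚ = 2 Σ_{x ∈ L(t) mod Γ} e_x⁻¹`»
  (`e_x` the order of the stabiliser of `x`); Remark 3.4.7: «the group of Atkin–Lehner involutions permutes the components
  transitively»; Prop. 3.4.1 (proof): «any nonscalar `x` … generates an imaginary quadratic field extension `k`».
* M.-F. Vignéras (1980) [VignerasLNM800] Ch. IV §3 B («Normalisateurs (Michon)»: `N(O)/O^×ℚ^× = (ℤ/2ℤ)^{2m}`; the points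
  fixed by elements of `G ⊃ Γ`), Ch. IV §1 (the stabiliser of a point is the unit group of the embedded order).

## What is proved (`y = p₁i + p₂j + p₃ij`, `t′ = Q(y)`)

* §1 **REDUCTION** (`normaliser_commute_pureVec_iff`): for `y ≠ 0`, `g ≠ 0`: **`g ∈ N(O₆)` and `gy = yg` ⟺ `g = q·(r + sy)` with
  `q ∈ ℚ_{>0}`, `r + sy ∈ O₆ ∩ ℚ(y)`, `nr(r + sy) = r² + s²t′ ∣ 6`** (g33-#4 exhaustion; the commutant is `ℚ(y)`, g31-#8;
  conversely an element of `O₆` of norm dividing `6` is `v·w_d` and normalises). So `Stab_{Γ₆⁺}(z_y)/ℚ^×` is the set of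
  `±`-pairs of elements of `ℚ(y) ∩ O₆` of norm `1, 2, 3` or `6`, and its part over `X₆^{(d)}` consists of those of norm `1` or `d`.
* §2 **`t′ = 1` (`P₆ = z_i`, `P₁₃₅ = z_E`)** (`normaliser_commute_iff_of_norm_one`): `(r, s) ∈ {(±1, 0), (0, ±1), (±1, ±1)}` —
  EIGHT elements `±1, ±y` (norm `1`), `±1 ± y` (norm `2`); modulo `ℚ^×`: `{1, y, 1 + y, 1 − y}`, so
  **`e = 2 | 4 | 2 | 2 | 4` on `X₆ | X₆^{(2)} | X₆^{(3)} | X₆^{(6)} | X₆⁺`** (Table 9: `e_{P₆} = 4` on `t₆⁺`; Thm 1.1: order `2` on `X₆`).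
* §3 **`t′ = 3` (`P₄ = z_{R₁}`, `P₂ = z_{R₂}`)** (`normaliser_commute_iff_of_norm_three`): `ℚ(y) ∩ O₆ = ℤ[(1 + y)/2]`,
  `m² + mN + N² ∈ {1, 3}` — TWELVE elements `±1, ±(1 ± y)/2` (norm `1`), `±y, ±(3 ± y)/2` (norm `3`); modulo `ℚ^×` six classes,
  **`e = 3 | 3 | 6 | 3 | 6`** (Table 9: `e_{P₄} = 6`; Thm 1.1: order `3` on `X₆`).
* §4 **`t′ = 6` (`P₀ = z_{S₂}`, `P₇ = z_{S₁}`)** (`normaliser_commute_iff_of_norm_six`): `(r, s) ∈ {(±1, 0), (0, ±1)}` — `±1`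
  (norm `1`), `±y` (norm `6`): **`e = 1 | 1 | 1 | 2 | 2`** — VERBATIM §7: «`P₀` is an elliptic point for `X₆^{(6)}` and `X₆⁺`, but it
  is not elliptic for `X₆`, `X₆^{(2)}` and `X₆^{(3)}`» (Table 9: `e_{P₀} = 2`).
* §5 **GENERIC POINTS ARE NOT ELLIPTIC ON ANY `X₆^{(d)}` OR `X₆⁺`**: for primitive `y` with `t′ ≢ 3 (mod 4)`, `t′ > 6`, or
  `t′ ≡ 3 (mod 4)`, `t′ > 23`: `g ∈ N(O₆)`, `gy = yg`, `g ≠ 0 ⟺ g ∈ ℚ^×` (`normaliser_commute_iff_generic`,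
  `normaliser_commute_iff_generic_of_three_mod_four`; `m² + t′n² ≤ 6`, resp. `(2m + N)² + t′N² ≤ 24`, forces `n = 0`).
* §6 THE NAMED POINTS: `i`, `R₁ = 3i + j + ij`, `S₂ = 3i + ij` (`normaliser_commute_i_iff`, `normaliser_commute_R1_iff`,
  `normaliser_commute_S2_iff`) — the isotropy of the three vertices of `t₆⁺ = [P₀, P₄, P₆]`: `2, 6, 4`.

## Honest scope

As in g31-#8/g32-#3, stabilisers are LISTED elementwise as `ℚ_{>0}`-multiples of explicit `r + sy` (no `Subgroup`, no
quotient by `ℚ^×`, no cardinality API); «`e` on `X₆^{(d)}`» is read off from the norms of the listed elements (`nr ∈ {1, d}`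
selects the coset `Γ₆ ⊔ Γ₆w_d`, by g32-#3 `norm_two_iff_coset`/`…three…`/`…six…` and g31-#3 `atkinLehner_classes_distinct`),
not stated as an equation `e = …`. That a positive-norm element FIXING `z_y ∈ 𝔥` commutes or anticommutes with `y` is g27-#2 /
g32-#3 and is not restated; only commuting elements are classified here. Only `t′ ∈ {1, 3, 6}` and the generic ranges of §5 are
treated (the remaining `t′ ≤ 23` do not occur as `Q` of a special vector of `X₆`, KRY Prop. 3.4.5, but that is not invoked).
0 definitions, 0 named facts, 0 instances — net debt `0`.

## References
* [BayerTravesa2007] P. Bayer, A. Travesa, *Uniformizing functions for certain Shimura curves, in the case D = 6*, Acta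
  Arith. 126 (2007), §1 Thm. 1.1, §2 p. 318, §7 p. 332, Table 9.
* [KudlaRapoportYang2006] S. Kudla, M. Rapoport, T. Yang, *Modular Forms and Special Cycles on Shimura Curves*, Ann. of
  Math. Stud. 161 (2006), §3.4 Prop. 3.4.1, (3.4.13)–(3.4.14), Remark 3.4.7.
* [VignerasLNM800] M.-F. Vignéras, *Arithmétique des algèbres de quaternions*, LNM 800 (1980), Ch. IV §1, §3 B.
-/

noncomputable section

set_option maxSynthPendingDepth 3

open Quaternion Function

namespace Literature.Geometry.Kaehler.ComplexTorus.QuaternionType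

/-! ## §1 Reduction: `Stab_{N(O₆)}(y) = ℚ_{>0}·{h ∈ ℚ(y) ∩ O₆ : nr h ∣ 6}` -/

section Reduction
set_option maxHeartbeats 400000 in -- buildfix (bf3-g31): 160k/180k FAIL, 200k PASS at accept time; line-neutral budget line
/-- **`g ∈ N(O₆)` COMMUTES WITH `y ≠ 0` IFF `g = q·(r + sy)`, `q > 0`, `r + sy ∈ O₆`, `r² + s²Q(y) ∣ 6`** — the stabiliser of
`z_y` in `Γ₆⁺ = N(O₆)` modulo `ℚ^×` is the set of elements of the CM order `ℚ(y) ∩ O₆` of norm dividing `6`, up to sign.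
(⟹: g33-#4 `exists_eq_smul_of_normalises_maxOrder` gives `g = q·h`, `h ∈ O₆`, `nr h ∣ 6`, and `h` commutes with `y`, so
`h ∈ ℚ + ℚy` by g31-#8; ⟸: `h = v·(1 + i)^k μ^l` normalises, g33-#4.) [cite: BayerTravesa2007, §2 p. 318 («The elements of `N(O₆)` of positive reduced norm define a subgroup … `Γ₆⁺`»)] [cite: VignerasLNM800, Ch. IV §1 and §3 B] [cite: KudlaRapoportYang2006, §3.4 Prop. 3.4.1 (proof) and (3.4.14)] -/
theorem normaliser_commute_pureVec_iff {p : Fin 3 → ℤ} (hp : p ≠ 0) {g : ℍ[ℚ,((-1 : ℤ) : ℚ),((3 : ℤ) : ℚ)]} (hg0 : g ≠ 0) :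
    ((∀ x, (x ∈ order (-1) 3 ∨ x - ⟨1/2, 1/2, 1/2, -1/2⟩ ∈ order (-1) 3) →
        ∃ z, (z ∈ order (-1) 3 ∨ z - ⟨1/2, 1/2, 1/2, -1/2⟩ ∈ order (-1) 3) ∧ x * g = g * z) ∧
      g * ⟨0, p 0, p 1, p 2⟩ = ⟨0, p 0, p 1, p 2⟩ * g) ↔
      ∃ q r s : ℚ, 0 < q ∧
        ((r : ℍ[ℚ,((-1 : ℤ) : ℚ),((3 : ℤ) : ℚ)]) + s • ⟨0, p 0, p 1, p 2⟩ ∈ order (-1) 3 ∨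
          (r : ℍ[ℚ,((-1 : ℤ) : ℚ),((3 : ℤ) : ℚ)]) + s • ⟨0, p 0, p 1, p 2⟩ - ⟨1/2, 1/2, 1/2, -1/2⟩ ∈ order (-1) 3) ∧
        (∃ d : ℤ, d ∣ 6 ∧ r ^ 2 + s ^ 2 * ((p 0 : ℚ) ^ 2 - 3 * (p 1 : ℚ) ^ 2 - 3 * (p 2 : ℚ) ^ 2) = d) ∧
        g = q • ((r : ℍ[ℚ,((-1 : ℤ) : ℚ),((3 : ℤ) : ℚ)]) + s • ⟨0, p 0, p 1, p 2⟩) := by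
  constructor
  · rintro ⟨hN, hc⟩
    obtain ⟨q, h, hq, hh, ⟨d, hd, hdn⟩, rfl⟩ := exists_eq_smul_of_normalises_maxOrder hg0 hN
    have hc' : h * ⟨0, p 0, p 1, p 2⟩ = ⟨0, p 0, p 1, p 2⟩ * h := by
      rw [smul_mul_assoc, mul_smul_comm] at hc
      simpa only [inv_smul_smul₀ hq.ne'] using congrArg (q⁻¹ • ·) hc
    obtain ⟨s, hs⟩ := (commute_pureVec_iff hp h).1 hc'
    refine ⟨q, h.re, s, hq, hs ▸ hh, ⟨d, hd, ?_⟩, by rw [← hs]⟩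
    rw [← norm_coe_add_smul_pureVec, ← hs, hdn]
  · rintro ⟨q, r, s, hq, hh, ⟨d, hd, hdn⟩, rfl⟩
    have hn : ((((r : ℍ[ℚ,((-1 : ℤ) : ℚ),((3 : ℤ) : ℚ)]) + s • ⟨0, p 0, p 1, p 2⟩)) *
        star ((r : ℍ[ℚ,((-1 : ℤ) : ℚ),((3 : ℤ) : ℚ)]) + s • ⟨0, p 0, p 1, p 2⟩)).re = d := by
      rw [norm_coe_add_smul_pureVec, hdn]
    obtain ⟨v, k, l, hv, h1, -, -, e⟩ := exists_unit_mul_atkinLehner_of_norm_dvd_six hh hd hn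
    refine ⟨(normalises_of_eq_smul_unit_mul_atkinLehner hv h1 k l (q := q)
      (g := q • ((r : ℍ[ℚ,((-1 : ℤ) : ℚ),((3 : ℤ) : ℚ)]) + s • ⟨0, p 0, p 1, p 2⟩)) (by rw [← e])).2.2, ?_⟩
    rw [smul_mul_assoc, mul_smul_comm, coe_add_smul_mul_pureVec_comm]

end Reduction

/-! ## §2 `t′ = 1`: `P₆ = z_i` — eight elements, `e = 2 | 4 | 2 | 2 | 4` -/

section NormOne

/-- **`Q(y) = 1` (e.g. `y = i`, `E`): `g ∈ N(O₆) ∖ 0` commutes with `y` iff `g = q·(r + sy)`, `q > 0`,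
`(r, s) ∈ {(±1, 0), (0, ±1), (±1, ±1)}`** — `ℚ(y) ∩ O₆ = ℤ[y] ≅ ℤ[i]` (g31-#4), `m² + n² ∈ {1, 2}` (`3, 6` are not sums of
two squares): the stabiliser of `P₆` in `Γ₆⁺` is `ℚ^×·{1, i, 1 + i, 1 − i}` (norms `1, 1, 2, 2`), of order `4` modulo `ℚ^×`
(`(1 + i)² = 2i`): `e_{P₆} = 4` on `X₆⁺` and on `X₆^{(2)}`, `= 2` on `X₆, X₆^{(3)}, X₆^{(6)}`. [cite: BayerTravesa2007, Table 9 («`e_{P₆} = 4`» on `t₆⁺`) and §1 Thm. 1.1 («`P₆` … elliptic of order `2`»)] [cite: KudlaRapoportYang2006, §3.4 (3.4.14)] -/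
theorem normaliser_commute_iff_of_norm_one {p : Fin 3 → ℤ} (hprim : ∃ w : Fin 3 → ℤ, ∑ k, w k * p k = 1)
    (ht : p 0 ^ 2 - 3 * p 1 ^ 2 - 3 * p 2 ^ 2 = 1) {g : ℍ[ℚ,((-1 : ℤ) : ℚ),((3 : ℤ) : ℚ)]} (hg0 : g ≠ 0) :
    ((∀ x, (x ∈ order (-1) 3 ∨ x - ⟨1/2, 1/2, 1/2, -1/2⟩ ∈ order (-1) 3) →
        ∃ z, (z ∈ order (-1) 3 ∨ z - ⟨1/2, 1/2, 1/2, -1/2⟩ ∈ order (-1) 3) ∧ x * g = g * z) ∧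
      g * ⟨0, p 0, p 1, p 2⟩ = ⟨0, p 0, p 1, p 2⟩ * g) ↔
      ∃ q r s : ℚ, 0 < q ∧ g = q • ((r : ℍ[ℚ,((-1 : ℤ) : ℚ),((3 : ℤ) : ℚ)]) + s • ⟨0, p 0, p 1, p 2⟩) ∧
        (r, s) ∈ ({(1, 0), (-1, 0), (0, 1), (0, -1), (1, 1), (1, -1), (-1, 1), (-1, -1)} : Finset (ℚ × ℚ)) := by
  have hp : p ≠ 0 := by
    rintro rfl; obtain ⟨w, hw⟩ := hprim; simp at hw
  have h4 : (p 0 ^ 2 - 3 * p 1 ^ 2 - 3 * p 2 ^ 2) % 4 ≠ 3 := by rw [ht]; decide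
  have ht' : ((p 0 : ℚ) ^ 2 - 3 * (p 1 : ℚ) ^ 2 - 3 * (p 2 : ℚ) ^ 2) = 1 := by exact_mod_cast ht
  rw [normaliser_commute_pureVec_iff hp hg0]
  constructor
  · rintro ⟨q, r, s, hq, hh, ⟨d, hd, hdn⟩, hg⟩
    obtain ⟨⟨m, rfl⟩, ⟨n, rfl⟩⟩ := (coe_add_smul_maxOrder_iff_of_norm_emod_four_ne hprim h4 r s).1 hh
    rw [ht', mul_one] at hdn
    have hmn : m ^ 2 + n ^ 2 = d := by exact_mod_cast hdn
    have hd6 : d ≤ 6 := Int.le_of_dvd (by norm_num) hd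
    have hm : m ≤ 2 := by nlinarith [sq_nonneg n]
    have hm' : -2 ≤ m := by nlinarith [sq_nonneg n]
    have hn : n ≤ 2 := by nlinarith [sq_nonneg m]
    have hn' : -2 ≤ n := by nlinarith [sq_nonneg m]
    refine ⟨q, m, n, hq, hg, ?_⟩
    obtain ⟨k, hk⟩ := hd
    interval_cases m <;> interval_cases n <;> norm_num at hmn ⊢ <;> subst hmn <;> omega
  · rintro ⟨q, r, s, hq, hg, hrs⟩
    have mem : ∀ r s : ℚ, (∃ m : ℤ, r = m) → (∃ n : ℤ, s = n) → (r ^ 2 + s ^ 2 = 1 ∨ r ^ 2 + s ^ 2 = 2) →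
        ((r : ℍ[ℚ,((-1 : ℤ) : ℚ),((3 : ℤ) : ℚ)]) + s • ⟨0, p 0, p 1, p 2⟩ ∈ order (-1) 3 ∨
            (r : ℍ[ℚ,((-1 : ℤ) : ℚ),((3 : ℤ) : ℚ)]) + s • ⟨0, p 0, p 1, p 2⟩ - ⟨1/2, 1/2, 1/2, -1/2⟩ ∈ order (-1) 3) ∧
          ∃ d : ℤ, d ∣ 6 ∧ r ^ 2 + s ^ 2 * ((p 0 : ℚ) ^ 2 - 3 * (p 1 : ℚ) ^ 2 - 3 * (p 2 : ℚ) ^ 2) = d := by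
      intro r s hm hn h12
      refine ⟨(coe_add_smul_maxOrder_iff_of_norm_emod_four_ne hprim h4 r s).2 ⟨hm, hn⟩, ?_⟩
      rcases h12 with h | h
      · exact ⟨1, by norm_num, by rw [ht', mul_one, h]; norm_num⟩
      · exact ⟨2, by norm_num, by rw [ht', mul_one, h]; norm_num⟩
    simp only [Finset.mem_insert, Finset.mem_singleton, Prod.mk.injEq] at hrs
    rcases hrs with ⟨rfl, rfl⟩ | ⟨rfl, rfl⟩ | ⟨rfl, rfl⟩ | ⟨rfl, rfl⟩ | ⟨rfl, rfl⟩ | ⟨rfl, rfl⟩ | ⟨rfl, rfl⟩ |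
      ⟨rfl, rfl⟩
    · obtain ⟨h1, h2⟩ := mem (1) (0) ⟨1, by norm_num⟩ ⟨0, by norm_num⟩ (by norm_num)
      exact ⟨q, 1, 0, hq, h1, h2, hg⟩
    · obtain ⟨h1, h2⟩ := mem (-1) (0) ⟨-1, by norm_num⟩ ⟨0, by norm_num⟩ (by norm_num)
      exact ⟨q, -1, 0, hq, h1, h2, hg⟩
    · obtain ⟨h1, h2⟩ := mem (0) (1) ⟨0, by norm_num⟩ ⟨1, by norm_num⟩ (by norm_num)
      exact ⟨q, 0, 1, hq, h1, h2, hg⟩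
    · obtain ⟨h1, h2⟩ := mem (0) (-1) ⟨0, by norm_num⟩ ⟨-1, by norm_num⟩ (by norm_num)
      exact ⟨q, 0, -1, hq, h1, h2, hg⟩
    · obtain ⟨h1, h2⟩ := mem (1) (1) ⟨1, by norm_num⟩ ⟨1, by norm_num⟩ (by norm_num)
      exact ⟨q, 1, 1, hq, h1, h2, hg⟩
    · obtain ⟨h1, h2⟩ := mem (1) (-1) ⟨1, by norm_num⟩ ⟨-1, by norm_num⟩ (by norm_num)
      exact ⟨q, 1, -1, hq, h1, h2, hg⟩
    · obtain ⟨h1, h2⟩ := mem (-1) (1) ⟨-1, by norm_num⟩ ⟨1, by norm_num⟩ (by norm_num)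
      exact ⟨q, -1, 1, hq, h1, h2, hg⟩
    · obtain ⟨h1, h2⟩ := mem (-1) (-1) ⟨-1, by norm_num⟩ ⟨-1, by norm_num⟩ (by norm_num)
      exact ⟨q, -1, -1, hq, h1, h2, hg⟩

end NormOne

/-! ## §3 `t′ = 3`: `P₄ = z_{R₁}` — twelve elements, `e = 3 | 3 | 6 | 3 | 6` -/

section NormThree

/-- **`Q(y) = 3` (e.g. `y = R₁ = 3i + j + ij`, `R₂`): `g ∈ N(O₆) ∖ 0` commutes with `y` iff `g = q·(r + sy)`, `q > 0`, `(r, s)` one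
of the TWELVE pairs `(±1, 0), ±(½, ½), ±(½, −½)` (the units `±1, ±(1 ± y)/2` of `ℤ[(1 + y)/2] ≅ ℤ[ζ₃]`, norm `1`) and
`(0, ±1), ±(3/2, ½), ±(3/2, −½)` (`±y, ±(3 ± y)/2`, norm `3`)** — `ℚ(y) ∩ O₆ = ℤ[(1 + y)/2]` (g31-#4), `m² + mN + N² ∈ {1, 3}`
(`2, 6` are not norms from `ℤ[ζ₃]`): the stabiliser of `P₄` in `Γ₆⁺` has six classes modulo `ℚ^×`, three of norm class `1` and
three of norm class `3`: `e_{P₄} = 6` on `X₆⁺` and `X₆^{(3)}`, `= 3` on `X₆, X₆^{(2)}, X₆^{(6)}`. [cite: BayerTravesa2007, Table 9 («`e_{P₄} = 6`» on `t₆⁺`) and §1 Thm. 1.1 («`P₂, P₄` are elliptic of order `3`»)] [cite: KudlaRapoportYang2006, §3.4 (3.4.6) («`w(c²d)`») and (3.4.14)] -/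
theorem normaliser_commute_iff_of_norm_three {p : Fin 3 → ℤ} (hprim : ∃ w : Fin 3 → ℤ, ∑ k, w k * p k = 1)
    (ht : p 0 ^ 2 - 3 * p 1 ^ 2 - 3 * p 2 ^ 2 = 3) {g : ℍ[ℚ,((-1 : ℤ) : ℚ),((3 : ℤ) : ℚ)]} (hg0 : g ≠ 0) :
    ((∀ x, (x ∈ order (-1) 3 ∨ x - ⟨1/2, 1/2, 1/2, -1/2⟩ ∈ order (-1) 3) →
        ∃ z, (z ∈ order (-1) 3 ∨ z - ⟨1/2, 1/2, 1/2, -1/2⟩ ∈ order (-1) 3) ∧ x * g = g * z) ∧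
      g * ⟨0, p 0, p 1, p 2⟩ = ⟨0, p 0, p 1, p 2⟩ * g) ↔
      ∃ q r s : ℚ, 0 < q ∧ g = q • ((r : ℍ[ℚ,((-1 : ℤ) : ℚ),((3 : ℤ) : ℚ)]) + s • ⟨0, p 0, p 1, p 2⟩) ∧
        (r, s) ∈ ({(1, 0), (-1, 0), (1/2, 1/2), (-1/2, -1/2), (1/2, -1/2), (-1/2, 1/2),
          (0, 1), (0, -1), (3/2, 1/2), (-3/2, -1/2), (3/2, -1/2), (-3/2, 1/2)} : Finset (ℚ × ℚ)) := by
  have hp : p ≠ 0 := by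
    rintro rfl; obtain ⟨w, hw⟩ := hprim; simp at hw
  have h3 : (p 0 ^ 2 - 3 * p 1 ^ 2 - 3 * p 2 ^ 2) % 4 = 3 := by rw [ht]; decide
  have ht' : ((p 0 : ℚ) ^ 2 - 3 * (p 1 : ℚ) ^ 2 - 3 * (p 2 : ℚ) ^ 2) = 3 := by exact_mod_cast ht
  rw [normaliser_commute_pureVec_iff hp hg0]
  constructor
  · rintro ⟨q, r, s, hq, hh, ⟨d, hd, hdn⟩, hg⟩
    obtain ⟨⟨N, hN⟩, ⟨m, hm⟩⟩ := (coe_add_smul_maxOrder_iff_of_norm_emod_four_eq hprim h3 r s).1 hh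
    have hs : s = (N : ℚ) / 2 := by linarith
    have hr : r = m + (N : ℚ) / 2 := by linarith
    subst hs
    subst hr
    rw [ht'] at hdn
    have hmn : m ^ 2 + m * N + N ^ 2 = d := by
      have e : ((m ^ 2 + m * N + N ^ 2 : ℤ) : ℚ) = d := by push_cast; linear_combination hdn
      exact_mod_cast e
    have hd6 : d ≤ 6 := Int.le_of_dvd (by norm_num) hd
    have hN2 : N ≤ 2 := by nlinarith [sq_nonneg (2 * m + N)]
    have hN2' : -2 ≤ N := by nlinarith [sq_nonneg (2 * m + N)]
    have hm2 : m ≤ 2 := by nlinarith [sq_nonneg (2 * N + m)]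
    have hm2' : -2 ≤ m := by nlinarith [sq_nonneg (2 * N + m)]
    refine ⟨q, _, _, hq, hg, ?_⟩
    obtain ⟨k, hk⟩ := hd
    interval_cases m <;> interval_cases N <;> norm_num at hmn ⊢ <;> subst hmn <;> omega
  · rintro ⟨q, r, s, hq, hg, hrs⟩
    have mem : ∀ r s : ℚ, (∃ N : ℤ, 2 * s = N) → (∃ m : ℤ, r - s = m) →
        (r ^ 2 + s ^ 2 * 3 = 1 ∨ r ^ 2 + s ^ 2 * 3 = 3) →
        ((r : ℍ[ℚ,((-1 : ℤ) : ℚ),((3 : ℤ) : ℚ)]) + s • ⟨0, p 0, p 1, p 2⟩ ∈ order (-1) 3 ∨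
            (r : ℍ[ℚ,((-1 : ℤ) : ℚ),((3 : ℤ) : ℚ)]) + s • ⟨0, p 0, p 1, p 2⟩ - ⟨1/2, 1/2, 1/2, -1/2⟩ ∈ order (-1) 3) ∧
          ∃ d : ℤ, d ∣ 6 ∧ r ^ 2 + s ^ 2 * ((p 0 : ℚ) ^ 2 - 3 * (p 1 : ℚ) ^ 2 - 3 * (p 2 : ℚ) ^ 2) = d := by
      intro r s hN hm h13
      refine ⟨(coe_add_smul_maxOrder_iff_of_norm_emod_four_eq hprim h3 r s).2 ⟨hN, hm⟩, ?_⟩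
      rcases h13 with h | h
      · exact ⟨1, by norm_num, by rw [ht', h]; norm_num⟩
      · exact ⟨3, by norm_num, by rw [ht', h]; norm_num⟩
    simp only [Finset.mem_insert, Finset.mem_singleton, Prod.mk.injEq] at hrs
    rcases hrs with ⟨rfl, rfl⟩ | ⟨rfl, rfl⟩ | ⟨rfl, rfl⟩ | ⟨rfl, rfl⟩ | ⟨rfl, rfl⟩ | ⟨rfl, rfl⟩ | ⟨rfl, rfl⟩ |
      ⟨rfl, rfl⟩ | ⟨rfl, rfl⟩ | ⟨rfl, rfl⟩ | ⟨rfl, rfl⟩ | ⟨rfl, rfl⟩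
    · obtain ⟨h1, h2⟩ := mem (1) (0) ⟨0, by norm_num⟩ ⟨1, by norm_num⟩ (by norm_num)
      exact ⟨q, 1, 0, hq, h1, h2, hg⟩
    · obtain ⟨h1, h2⟩ := mem (-1) (0) ⟨0, by norm_num⟩ ⟨-1, by norm_num⟩ (by norm_num)
      exact ⟨q, -1, 0, hq, h1, h2, hg⟩
    · obtain ⟨h1, h2⟩ := mem (1/2) (1/2) ⟨1, by norm_num⟩ ⟨0, by norm_num⟩ (by norm_num)
      exact ⟨q, 1/2, 1/2, hq, h1, h2, hg⟩
    · obtain ⟨h1, h2⟩ := mem (-1/2) (-1/2) ⟨-1, by norm_num⟩ ⟨0, by norm_num⟩ (by norm_num)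
      exact ⟨q, -1/2, -1/2, hq, h1, h2, hg⟩
    · obtain ⟨h1, h2⟩ := mem (1/2) (-1/2) ⟨-1, by norm_num⟩ ⟨1, by norm_num⟩ (by norm_num)
      exact ⟨q, 1/2, -1/2, hq, h1, h2, hg⟩
    · obtain ⟨h1, h2⟩ := mem (-1/2) (1/2) ⟨1, by norm_num⟩ ⟨-1, by norm_num⟩ (by norm_num)
      exact ⟨q, -1/2, 1/2, hq, h1, h2, hg⟩
    · obtain ⟨h1, h2⟩ := mem (0) (1) ⟨2, by norm_num⟩ ⟨-1, by norm_num⟩ (by norm_num)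
      exact ⟨q, 0, 1, hq, h1, h2, hg⟩
    · obtain ⟨h1, h2⟩ := mem (0) (-1) ⟨-2, by norm_num⟩ ⟨1, by norm_num⟩ (by norm_num)
      exact ⟨q, 0, -1, hq, h1, h2, hg⟩
    · obtain ⟨h1, h2⟩ := mem (3/2) (1/2) ⟨1, by norm_num⟩ ⟨1, by norm_num⟩ (by norm_num)
      exact ⟨q, 3/2, 1/2, hq, h1, h2, hg⟩
    · obtain ⟨h1, h2⟩ := mem (-3/2) (-1/2) ⟨-1, by norm_num⟩ ⟨-1, by norm_num⟩ (by norm_num)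
      exact ⟨q, -3/2, -1/2, hq, h1, h2, hg⟩
    · obtain ⟨h1, h2⟩ := mem (3/2) (-1/2) ⟨-1, by norm_num⟩ ⟨2, by norm_num⟩ (by norm_num)
      exact ⟨q, 3/2, -1/2, hq, h1, h2, hg⟩
    · obtain ⟨h1, h2⟩ := mem (-3/2) (1/2) ⟨1, by norm_num⟩ ⟨-2, by norm_num⟩ (by norm_num)
      exact ⟨q, -3/2, 1/2, hq, h1, h2, hg⟩

end NormThree

/-! ## §4 `t′ = 6`: `P₀ = z_{S₂}` — four elements, `e = 1 | 1 | 1 | 2 | 2` -/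

section NormSix

/-- **`Q(y) = 6` (e.g. `y = S₂ = 3i + ij = w₆`, `S₁ = 3i + j`): `g ∈ N(O₆) ∖ 0` commutes with `y` iff `g = q·(r + sy)`, `q > 0`,
`(r, s) ∈ {(±1, 0), (0, ±1)}`** — `ℚ(y) ∩ O₆ = ℤ[y] ≅ ℤ[√−6]`, `m² + 6n² ∈ {1, 2, 3, 6}` forces `(m, n) = (±1, 0)` (norm `1`) or
`(0, ±1)` (norm `6`): modulo `ℚ^×` the stabiliser of `P₀` is `{1, y}`, trivial on `X₆, X₆^{(2)}, X₆^{(3)}` and of order `2` on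
`X₆^{(6)}` and `X₆⁺` — VERBATIM «`P₀` is an elliptic point for `X₆^{(6)}` and `X₆⁺`, but it is not elliptic for `X₆`, `X₆^{(2)}`
and `X₆^{(3)}`». [cite: BayerTravesa2007, §7 p. 332 and Table 9 («`e_{P₀} = 2`»); Prop. 2.1 (a) («`ω₆[P₀, P₃] = [P₀, P₆]`»)] [cite: KudlaRapoportYang2006, §3.4 (3.4.14)] -/
theorem normaliser_commute_iff_of_norm_six {p : Fin 3 → ℤ} (hprim : ∃ w : Fin 3 → ℤ, ∑ k, w k * p k = 1)
    (ht : p 0 ^ 2 - 3 * p 1 ^ 2 - 3 * p 2 ^ 2 = 6) {g : ℍ[ℚ,((-1 : ℤ) : ℚ),((3 : ℤ) : ℚ)]} (hg0 : g ≠ 0) :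
    ((∀ x, (x ∈ order (-1) 3 ∨ x - ⟨1/2, 1/2, 1/2, -1/2⟩ ∈ order (-1) 3) →
        ∃ z, (z ∈ order (-1) 3 ∨ z - ⟨1/2, 1/2, 1/2, -1/2⟩ ∈ order (-1) 3) ∧ x * g = g * z) ∧
      g * ⟨0, p 0, p 1, p 2⟩ = ⟨0, p 0, p 1, p 2⟩ * g) ↔
      ∃ q r s : ℚ, 0 < q ∧ g = q • ((r : ℍ[ℚ,((-1 : ℤ) : ℚ),((3 : ℤ) : ℚ)]) + s • ⟨0, p 0, p 1, p 2⟩) ∧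
        (r, s) ∈ ({(1, 0), (-1, 0), (0, 1), (0, -1)} : Finset (ℚ × ℚ)) := by
  have hp : p ≠ 0 := by
    rintro rfl; obtain ⟨w, hw⟩ := hprim; simp at hw
  have h4 : (p 0 ^ 2 - 3 * p 1 ^ 2 - 3 * p 2 ^ 2) % 4 ≠ 3 := by rw [ht]; decide
  have ht' : ((p 0 : ℚ) ^ 2 - 3 * (p 1 : ℚ) ^ 2 - 3 * (p 2 : ℚ) ^ 2) = 6 := by exact_mod_cast ht
  rw [normaliser_commute_pureVec_iff hp hg0]
  constructor
  · rintro ⟨q, r, s, hq, hh, ⟨d, hd, hdn⟩, hg⟩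
    obtain ⟨⟨m, rfl⟩, ⟨n, rfl⟩⟩ := (coe_add_smul_maxOrder_iff_of_norm_emod_four_ne hprim h4 r s).1 hh
    rw [ht'] at hdn
    have hmn : m ^ 2 + n ^ 2 * 6 = d := by exact_mod_cast hdn
    have hd6 : d ≤ 6 := Int.le_of_dvd (by norm_num) hd
    have hm : m ≤ 2 := by nlinarith [sq_nonneg n]
    have hm' : -2 ≤ m := by nlinarith [sq_nonneg n]
    have hn : n ≤ 1 := by nlinarith [sq_nonneg m]
    have hn' : -1 ≤ n := by nlinarith [sq_nonneg m]
    refine ⟨q, m, n, hq, hg, ?_⟩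
    obtain ⟨k, hk⟩ := hd
    interval_cases m <;> interval_cases n <;> norm_num at hmn ⊢ <;> subst hmn <;> omega
  · rintro ⟨q, r, s, hq, hg, hrs⟩
    have mem : ∀ r s : ℚ, (∃ m : ℤ, r = m) → (∃ n : ℤ, s = n) → (r ^ 2 + s ^ 2 * 6 = 1 ∨ r ^ 2 + s ^ 2 * 6 = 6) →
        ((r : ℍ[ℚ,((-1 : ℤ) : ℚ),((3 : ℤ) : ℚ)]) + s • ⟨0, p 0, p 1, p 2⟩ ∈ order (-1) 3 ∨
            (r : ℍ[ℚ,((-1 : ℤ) : ℚ),((3 : ℤ) : ℚ)]) + s • ⟨0, p 0, p 1, p 2⟩ - ⟨1/2, 1/2, 1/2, -1/2⟩ ∈ order (-1) 3) ∧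
          ∃ d : ℤ, d ∣ 6 ∧ r ^ 2 + s ^ 2 * ((p 0 : ℚ) ^ 2 - 3 * (p 1 : ℚ) ^ 2 - 3 * (p 2 : ℚ) ^ 2) = d := by
      intro r s hm hn h16
      refine ⟨(coe_add_smul_maxOrder_iff_of_norm_emod_four_ne hprim h4 r s).2 ⟨hm, hn⟩, ?_⟩
      rcases h16 with h | h
      · exact ⟨1, by norm_num, by rw [ht', h]; norm_num⟩
      · exact ⟨6, by norm_num, by rw [ht', h]; norm_num⟩
    simp only [Finset.mem_insert, Finset.mem_singleton, Prod.mk.injEq] at hrs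
    rcases hrs with ⟨rfl, rfl⟩ | ⟨rfl, rfl⟩ | ⟨rfl, rfl⟩ | ⟨rfl, rfl⟩
    · obtain ⟨h1, h2⟩ := mem (1) (0) ⟨1, by norm_num⟩ ⟨0, by norm_num⟩ (by norm_num)
      exact ⟨q, 1, 0, hq, h1, h2, hg⟩
    · obtain ⟨h1, h2⟩ := mem (-1) (0) ⟨-1, by norm_num⟩ ⟨0, by norm_num⟩ (by norm_num)
      exact ⟨q, -1, 0, hq, h1, h2, hg⟩
    · obtain ⟨h1, h2⟩ := mem (0) (1) ⟨0, by norm_num⟩ ⟨1, by norm_num⟩ (by norm_num)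
      exact ⟨q, 0, 1, hq, h1, h2, hg⟩
    · obtain ⟨h1, h2⟩ := mem (0) (-1) ⟨0, by norm_num⟩ ⟨-1, by norm_num⟩ (by norm_num)
      exact ⟨q, 0, -1, hq, h1, h2, hg⟩

end NormSix

/-! ## §5 Generic special points are not elliptic on any `X₆^{(d)}` or on `X₆⁺` -/

section Generic

/-- `q·(r + 0·y) = qr` as a scalar of `B`. [folklore] -/
private theorem smul_coe_add_smul_eq_coe {q r s t : ℚ} (p : Fin 3 → ℤ) (hs : s = 0) (ht : q * r = t) :
    q • ((r : ℍ[ℚ,((-1 : ℤ) : ℚ),((3 : ℤ) : ℚ)]) + s • ⟨0, p 0, p 1, p 2⟩) =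
      (t : ℍ[ℚ,((-1 : ℤ) : ℚ),((3 : ℤ) : ℚ)]) := by
  subst hs
  rw [coe_add_smul_pureVec, QuaternionAlgebra.smul_mk, QuaternionAlgebra.coe, QuaternionAlgebra.mk.injEq]
  simp only [smul_eq_mul, zero_mul, mul_zero, and_true]
  exact ht

/-- Non-zero scalars normalise `O₆` and commute with everything. [folklore] -/
private theorem coe_normalises_and_commutes {q : ℚ} (y : ℍ[ℚ,((-1 : ℤ) : ℚ),((3 : ℤ) : ℚ)]) :
    (∀ x, (x ∈ order (-1) 3 ∨ x - ⟨1/2, 1/2, 1/2, -1/2⟩ ∈ order (-1) 3) →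
        ∃ z, (z ∈ order (-1) 3 ∨ z - ⟨1/2, 1/2, 1/2, -1/2⟩ ∈ order (-1) 3) ∧
          x * (q : ℍ[ℚ,((-1 : ℤ) : ℚ),((3 : ℤ) : ℚ)]) = (q : ℍ[ℚ,((-1 : ℤ) : ℚ),((3 : ℤ) : ℚ)]) * z) ∧
      (q : ℍ[ℚ,((-1 : ℤ) : ℚ),((3 : ℤ) : ℚ)]) * y = y * (q : ℍ[ℚ,((-1 : ℤ) : ℚ),((3 : ℤ) : ℚ)]) :=
  ⟨fun x hx ↦ ⟨x, hx, (QuaternionAlgebra.coe_commutes q x).symm⟩, QuaternionAlgebra.coe_commutes q y⟩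

/-- **GENERIC `t′ ≢ 3 (mod 4)`, `t′ > 6`: the stabiliser in `Γ₆⁺` is `ℚ^×` only** — for primitive `y`, `ℚ(y) ∩ O₆ = ℤ[y]` and
`m² + t′n² ∣ 6` forces `n = 0`, `m = ±1`: `g ∈ N(O₆) ∖ 0` commutes with `y` iff `g` is a non-zero scalar. Such `z_y` is not an
elliptic point of `X₆`, of any `X₆^{(d)}`, or of `X₆⁺`. [cite: BayerTravesa2007, §7 p. 332 and Table 9 (the only elliptic vertices of `t₆⁺` are `P₀, P₄, P₆`)] [cite: KudlaRapoportYang2006, §3.4 (3.4.6) («`w(c²d) = 2`» generically) and (3.4.14)] -/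
theorem normaliser_commute_iff_generic {p : Fin 3 → ℤ} (hprim : ∃ w : Fin 3 → ℤ, ∑ k, w k * p k = 1)
    (h4 : (p 0 ^ 2 - 3 * p 1 ^ 2 - 3 * p 2 ^ 2) % 4 ≠ 3) (h6 : 6 < p 0 ^ 2 - 3 * p 1 ^ 2 - 3 * p 2 ^ 2)
    {g : ℍ[ℚ,((-1 : ℤ) : ℚ),((3 : ℤ) : ℚ)]} (hg0 : g ≠ 0) :
    ((∀ x, (x ∈ order (-1) 3 ∨ x - ⟨1/2, 1/2, 1/2, -1/2⟩ ∈ order (-1) 3) →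
        ∃ z, (z ∈ order (-1) 3 ∨ z - ⟨1/2, 1/2, 1/2, -1/2⟩ ∈ order (-1) 3) ∧ x * g = g * z) ∧
      g * ⟨0, p 0, p 1, p 2⟩ = ⟨0, p 0, p 1, p 2⟩ * g) ↔
      ∃ q : ℚ, q ≠ 0 ∧ g = (q : ℍ[ℚ,((-1 : ℤ) : ℚ),((3 : ℤ) : ℚ)]) := by
  have hp : p ≠ 0 := by
    rintro rfl; obtain ⟨w, hw⟩ := hprim; simp at hw
  constructor
  · intro h
    obtain ⟨q, r, s, hq, hh, ⟨d, hd, hdn⟩, hg⟩ := (normaliser_commute_pureVec_iff hp hg0).1 h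
    obtain ⟨⟨m, rfl⟩, ⟨n, rfl⟩⟩ := (coe_add_smul_maxOrder_iff_of_norm_emod_four_ne hprim h4 _ _).1 hh
    have hmn : m ^ 2 + n ^ 2 * (p 0 ^ 2 - 3 * p 1 ^ 2 - 3 * p 2 ^ 2) = d := by exact_mod_cast hdn
    have hd6 : d ≤ 6 := Int.le_of_dvd (by norm_num) hd
    have hn : n = 0 := by
      by_contra hn
      have : 1 ≤ n ^ 2 := by nlinarith [sq_nonneg n, Int.one_le_abs hn, sq_abs n]
      nlinarith [sq_nonneg m]
    subst hn
    have hm2 : m ^ 2 = d := by simpa using hmn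
    have hm : m ≤ 2 := by nlinarith
    have hm' : -2 ≤ m := by nlinarith
    obtain ⟨k, hk⟩ := hd
    interval_cases m <;> norm_num at hm2 <;> subst hm2
    · omega
    · exact ⟨-q, by linarith, by rw [hg]; exact smul_coe_add_smul_eq_coe p (by norm_num) (by push_cast; ring)⟩
    · omega
    · exact ⟨q, hq.ne', by rw [hg]; exact smul_coe_add_smul_eq_coe p (by norm_num) (by push_cast; ring)⟩
    · omega
  · rintro ⟨q, -, rfl⟩
    exact coe_normalises_and_commutes _

/-- **GENERIC `t′ ≡ 3 (mod 4)`, `t′ > 23`: again `ℚ^×` only** — here `ℚ(y) ∩ O₆ = ℤ[(1 + y)/2]` and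
`4·nr = (2m + N)² + t′N² ≤ 24` forces `N = 0`. [cite: BayerTravesa2007, §7 p. 332 and Table 9] [cite: KudlaRapoportYang2006, §3.4 (3.4.6) and (3.4.14)] -/
theorem normaliser_commute_iff_generic_of_three_mod_four {p : Fin 3 → ℤ} (hprim : ∃ w : Fin 3 → ℤ, ∑ k, w k * p k = 1)
    (h3 : (p 0 ^ 2 - 3 * p 1 ^ 2 - 3 * p 2 ^ 2) % 4 = 3) (h23 : 23 < p 0 ^ 2 - 3 * p 1 ^ 2 - 3 * p 2 ^ 2)
    {g : ℍ[ℚ,((-1 : ℤ) : ℚ),((3 : ℤ) : ℚ)]} (hg0 : g ≠ 0) :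
    ((∀ x, (x ∈ order (-1) 3 ∨ x - ⟨1/2, 1/2, 1/2, -1/2⟩ ∈ order (-1) 3) →
        ∃ z, (z ∈ order (-1) 3 ∨ z - ⟨1/2, 1/2, 1/2, -1/2⟩ ∈ order (-1) 3) ∧ x * g = g * z) ∧
      g * ⟨0, p 0, p 1, p 2⟩ = ⟨0, p 0, p 1, p 2⟩ * g) ↔
      ∃ q : ℚ, q ≠ 0 ∧ g = (q : ℍ[ℚ,((-1 : ℤ) : ℚ),((3 : ℤ) : ℚ)]) := by
  have hp : p ≠ 0 := by
    rintro rfl; obtain ⟨w, hw⟩ := hprim; simp at hw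
  constructor
  · intro h
    obtain ⟨q, r, s, hq, hh, ⟨d, hd, hdn⟩, hg⟩ := (normaliser_commute_pureVec_iff hp hg0).1 h
    obtain ⟨⟨N, hN⟩, ⟨m, hm⟩⟩ := (coe_add_smul_maxOrder_iff_of_norm_emod_four_eq hprim h3 r s).1 hh
    have hs : s = (N : ℚ) / 2 := by linarith
    have hr : r = m + (N : ℚ) / 2 := by linarith
    subst hs
    subst hr
    set T : ℤ := p 0 ^ 2 - 3 * p 1 ^ 2 - 3 * p 2 ^ 2 with hT
    have hT' : ((p 0 : ℚ) ^ 2 - 3 * (p 1 : ℚ) ^ 2 - 3 * (p 2 : ℚ) ^ 2) = T := by rw [hT]; push_cast; ring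
    rw [hT'] at hdn
    have hmn : (2 * m + N) ^ 2 + N ^ 2 * T = 4 * d := by
      have e : (((2 * m + N) ^ 2 + N ^ 2 * T : ℤ) : ℚ) = ((4 * d : ℤ) : ℚ) := by
        push_cast; linear_combination 4 * hdn
      exact_mod_cast e
    have hd6 : d ≤ 6 := Int.le_of_dvd (by norm_num) hd
    have hT27 : 27 ≤ T := by omega
    have hN : N = 0 := by
      by_contra hN
      have h1 : 1 ≤ N ^ 2 := by nlinarith [sq_nonneg N, Int.one_le_abs hN, sq_abs N]
      have h27 : 27 ≤ N ^ 2 * T := by nlinarith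
      nlinarith [sq_nonneg (2 * m + N)]
    subst hN
    have hm2 : m ^ 2 = d := by nlinarith
    have hm1 : m ≤ 2 := by nlinarith
    have hm1' : -2 ≤ m := by nlinarith
    obtain ⟨k, hk⟩ := hd
    interval_cases m <;> norm_num at hm2 <;> subst hm2
    · omega
    · exact ⟨-q, by linarith, by rw [hg]; exact smul_coe_add_smul_eq_coe p (by norm_num) (by push_cast; ring)⟩
    · omega
    · exact ⟨q, hq.ne', by rw [hg]; exact smul_coe_add_smul_eq_coe p (by norm_num) (by push_cast; ring)⟩
    · omega
  · rintro ⟨q, -, rfl⟩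
    exact coe_normalises_and_commutes _

end Generic

/-! ## §6 The vertices of `t₆⁺ = [P₀, P₄, P₆]`: `e = 2, 6, 4` -/

section Named

/-- **`P₆ = z_i`: the stabiliser of `i` in `Γ₆⁺ = N(O₆)` is `ℚ_{>0}·{±1, ±i, ±1 ± i}`** — four classes modulo `ℚ^×`,
`e_{P₆}(X₆⁺) = 4` (Table 9), with `1 + i = w₂` itself: `e = 4` already on `X₆^{(2)}`, `e = 2` on `X₆` (Thm 1.1), `X₆^{(3)}`,
`X₆^{(6)}`. [cite: BayerTravesa2007, Table 9 and §1 Thm. 1.1] [cite: KudlaRapoportYang2006, §3.4 (3.4.14)] -/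
theorem normaliser_commute_i_iff {g : ℍ[ℚ,((-1 : ℤ) : ℚ),((3 : ℤ) : ℚ)]} (hg0 : g ≠ 0) :
    ((∀ x, (x ∈ order (-1) 3 ∨ x - ⟨1/2, 1/2, 1/2, -1/2⟩ ∈ order (-1) 3) →
        ∃ z, (z ∈ order (-1) 3 ∨ z - ⟨1/2, 1/2, 1/2, -1/2⟩ ∈ order (-1) 3) ∧ x * g = g * z) ∧
      g * ⟨0, 1, 0, 0⟩ = ⟨0, 1, 0, 0⟩ * g) ↔
      ∃ q r s : ℚ, 0 < q ∧ g = q • ((r : ℍ[ℚ,((-1 : ℤ) : ℚ),((3 : ℤ) : ℚ)]) + s • ⟨0, 1, 0, 0⟩) ∧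
        (r, s) ∈ ({(1, 0), (-1, 0), (0, 1), (0, -1), (1, 1), (1, -1), (-1, 1), (-1, -1)} : Finset (ℚ × ℚ)) := by
  simpa using normaliser_commute_iff_of_norm_one (p := ![1, 0, 0]) ⟨![1, 0, 0], by simp [Fin.sum_univ_three]⟩
    (by simp) hg0

/-- **`P₄ = z_{R₁}`, `R₁ = 3i + j + ij`: the stabiliser of `R₁` in `Γ₆⁺` is `ℚ_{>0}·{±1, ±(1 ± R₁)/2, ±R₁, ±(3 ± R₁)/2}`** — six
classes modulo `ℚ^×`: `e_{P₄}(X₆⁺) = 6` (Table 9), `6` on `X₆^{(3)}` (`R₁` has norm `3 = nr w₃`), `3` on `X₆` (Thm 1.1), `X₆^{(2)}`,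
`X₆^{(6)}`. [cite: BayerTravesa2007, Table 9 and §1 Thm. 1.1] [cite: KudlaRapoportYang2006, §3.4 (3.4.14)] -/
theorem normaliser_commute_R1_iff {g : ℍ[ℚ,((-1 : ℤ) : ℚ),((3 : ℤ) : ℚ)]} (hg0 : g ≠ 0) :
    ((∀ x, (x ∈ order (-1) 3 ∨ x - ⟨1/2, 1/2, 1/2, -1/2⟩ ∈ order (-1) 3) →
        ∃ z, (z ∈ order (-1) 3 ∨ z - ⟨1/2, 1/2, 1/2, -1/2⟩ ∈ order (-1) 3) ∧ x * g = g * z) ∧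
      g * ⟨0, 3, 1, 1⟩ = ⟨0, 3, 1, 1⟩ * g) ↔
      ∃ q r s : ℚ, 0 < q ∧ g = q • ((r : ℍ[ℚ,((-1 : ℤ) : ℚ),((3 : ℤ) : ℚ)]) + s • ⟨0, 3, 1, 1⟩) ∧
        (r, s) ∈ ({(1, 0), (-1, 0), (1/2, 1/2), (-1/2, -1/2), (1/2, -1/2), (-1/2, 1/2),
          (0, 1), (0, -1), (3/2, 1/2), (-3/2, -1/2), (3/2, -1/2), (-3/2, 1/2)} : Finset (ℚ × ℚ)) := by
  simpa using normaliser_commute_iff_of_norm_three (p := ![3, 1, 1]) ⟨![0, 1, 0], by simp [Fin.sum_univ_three]⟩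
    (by simp) hg0

/-- **`P₀ = z_{S₂}`, `S₂ = 3i + ij = w₆`: the stabiliser of `S₂` in `Γ₆⁺` is `ℚ_{>0}·{±1, ±S₂}`** — two classes modulo `ℚ^×`:
`e_{P₀} = 2` on `X₆⁺` and `X₆^{(6)}` (`S₂` has norm `6 = nr w₆`), `1` on `X₆, X₆^{(2)}, X₆^{(3)}` — «`P₀` is an elliptic point for
`X₆^{(6)}` and `X₆⁺`, but it is not elliptic for `X₆`, `X₆^{(2)}` and `X₆^{(3)}`». [cite: BayerTravesa2007, §7 p. 332 and Table 9] [cite: KudlaRapoportYang2006, §3.4 (3.4.14)] -/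
theorem normaliser_commute_S2_iff {g : ℍ[ℚ,((-1 : ℤ) : ℚ),((3 : ℤ) : ℚ)]} (hg0 : g ≠ 0) :
    ((∀ x, (x ∈ order (-1) 3 ∨ x - ⟨1/2, 1/2, 1/2, -1/2⟩ ∈ order (-1) 3) →
        ∃ z, (z ∈ order (-1) 3 ∨ z - ⟨1/2, 1/2, 1/2, -1/2⟩ ∈ order (-1) 3) ∧ x * g = g * z) ∧
      g * ⟨0, 3, 0, 1⟩ = ⟨0, 3, 0, 1⟩ * g) ↔
      ∃ q r s : ℚ, 0 < q ∧ g = q • ((r : ℍ[ℚ,((-1 : ℤ) : ℚ),((3 : ℤ) : ℚ)]) + s • ⟨0, 3, 0, 1⟩) ∧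
        (r, s) ∈ ({(1, 0), (-1, 0), (0, 1), (0, -1)} : Finset (ℚ × ℚ)) := by
  simpa using normaliser_commute_iff_of_norm_six (p := ![3, 0, 1]) ⟨![0, 0, 1], by simp [Fin.sum_univ_three]⟩
    (by simp) hg0

end Named

end Literature.Geometry.Kaehler.ComplexTorus.QuaternionType
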